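import Mathlib
import HarnessLib

/-!
# Conversions to the whole axis: the tanh, sinh and exp substitutions and the DE rules for `(0, ∞)` and `ℝ`

**Statement.** The changes of variable of Davis–Rabinowitz, Sect. 3.4.5 ("Conversions to the Whole Axis"), that
map a finite or semi-infinite interval onto `(-∞, ∞)` — the substitutions behind the tanh rule (3.4.5.2), the
`eʸ` rule (3.4.5.3), the transformation (3.4.5.1) and the double-exponential (DE) rules (3.4.5.11)–(3.4.5.12) of
Takahasi–Mori for the half line and the whole line — stated as identities of integrals that hold for EVERY integrand
`f : ℝ → ℝ` (no continuity or integrability hypothesis: both sides are Lebesgue integrals and integrability transfers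
along an injective `C¹` substitution, `MeasureTheory.integral_image_eq_integral_abs_deriv_smul`):

* `x = tanh u`: `∫ x in -1..1, f x = ∫ u, f (tanh u) / cosh² u` (`integral_tanh_substitution`; tanh rule);
* `x = c sinh u` (`c > 0`): `∫ x, f x = ∫ u, (c cosh u) f (c sinh u)` (`integral_sinh_substitution`; (3.4.5.1));
* `x = eᵘ`: `∫ x in Ioi 0, f x = ∫ u, eᵘ f (eᵘ)` (`integral_exp_substitution`; (3.4.5.3));
* the unit interval: `∫ x in 0..1, f x = ∫ u, f ((1 + tanh u)/2) / (2 cosh² u)` (`integral_unitInterval_tanh_substitution`;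
  Schwartz's `x = 1/(1 + e^{-y})` with `y = 2u`);
* DE for the half line and the whole line: `∫ x in Ioi 0, f x = ∫ u, f (exp (π/2 · sinh u)) · (π/2 · cosh u) ·
  exp (π/2 · sinh u)` (`integral_exp_sinh_substitution`, (3.4.5.11)); `∫ x, f x = ∫ u, f (sinh (π/2 · sinh u)) ·
  (π/2 · cosh u) · cosh (π/2 · sinh u)` (`integral_sinh_sinh_substitution`, (3.4.5.12)).

Prior art in the tree (NOT restated here): the finite-interval DE (tanh–sinh) transformation (3.4.5.10),
`x = tanh(μ sinh u)`, is `Literature.Analysis.Quadrature.TanhSinhTransformation`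
(`TanhSinh.integral_weight_smul_comp_node`, with its unit-interval form `TanhSinh.integral_unitWeight_smul_comp_unitNode`
and the truncation analysis); this file supplies the remaining conversions of Sect. 3.4.5 — the plain tanh rule
substitution and the half-line / whole-line ones.

**Why here.** These substitutions are the analytic half of the tanh, `eʸ` and DE quadrature rules: the rule is the
trapezoidal sum of the right-hand side. A certified engine that wants to use such nodes for endpoint-singular or
half-line integrands needs exactly these identities — and, read right to left, they let a BOX certificate on
`[-1, 1]` certify a whole-axis integral of the form `∫ g(tanh u) sech² u du`. Mathlib supplies
the change-of-variables theorem, `Real.tanh_bijOn`, `Real.sinh_surjective` and `Real.range_exp`.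

Honest framing: this is infrastructure for shared numerical engines serving client cells; rigour lives in the
verifiers (the kernel-checked certificate that consumes the identities); every published number belongs to a client
cell's ledger, not to the engines group. Nothing here is claimed as new mathematics.

References: P. J. Davis, P. Rabinowitz, *Methods of Numerical Integration*, 2nd ed. (1984), Sect. 3.4.5
(3.4.5.1)–(3.4.5.3), (3.4.5.10)–(3.4.5.12); H. Takahasi, M. Mori, Double exponential formulas for numerical
integration, Publ. RIMS Kyoto Univ. 9 (1974) 721–741 (the DE transformations).

AI-produced formalisation (H21 engines group, seat eng-quad-3 gen 66, 2026-08-24); Lean 4 + Mathlib, no `sorry`,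
standard axioms only.
-/

open _root_.MeasureTheory Set intervalIntegral Real
open scoped Interval

noncomputable section

namespace Literature.MeasureTheory.Integral

/-! ### Derivatives and images of the substitutions -/

/-- `tanh' u = 1 / cosh² u`. [cite: DavisRabinowitz1984, Sect. 3.4.5 (3.4.5.2)] -/
theorem hasDerivAt_tanh_one_div_cosh_sq (u : ℝ) : HasDerivAt tanh (1 / cosh u ^ 2) u := by
  have h := (hasDerivAt_sinh u).div (hasDerivAt_cosh u) (cosh_pos u).ne'
  have hfun : (sinh / cosh : ℝ → ℝ) = tanh := funext fun x => by simp [tanh_eq_sinh_div_cosh]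
  rw [hfun] at h
  refine h.congr_deriv ?_
  have hc : cosh u ^ 2 - sinh u ^ 2 = 1 := cosh_sq_sub_sinh_sq u
  rw [← hc]
  ring

/-- The image of the whole axis under `tanh` is `(-1, 1)`. [cite: DavisRabinowitz1984, Sect. 3.4.5 (3.4.5.2)] -/
theorem image_tanh_univ : tanh '' (univ : Set ℝ) = Ioo (-1) 1 := tanh_bijOn.image_eq

/-- The image of the whole axis under `u ↦ c sinh u` (`c ≠ 0`) is the whole axis.
[cite: DavisRabinowitz1984, Sect. 3.4.5 (3.4.5.1)] -/
theorem image_const_mul_sinh_univ {c : ℝ} (hc : c ≠ 0) : (fun u => c * sinh u) '' (univ : Set ℝ) = univ := by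
  rw [image_univ, range_eq_univ]
  intro x
  obtain ⟨u, hu⟩ := sinh_surjective (x / c)
  exact ⟨u, by simp only [hu]; field_simp⟩

/-- The image of the whole axis under `exp` is `(0, ∞)`. [cite: DavisRabinowitz1984, Sect. 3.4.5 (3.4.5.3)] -/
theorem image_exp_univ : exp '' (univ : Set ℝ) = Ioi 0 := by rw [image_univ, range_exp]

/-! ### The one-step substitutions -/

/-- **tanh substitution** (the substitution of the tanh rule (3.4.5.2)): for every `f`,
`∫ x in -1..1, f x = ∫ u, f (tanh u) / cosh² u`. [cite: DavisRabinowitz1984, Sect. 3.4.5 (3.4.5.2)] -/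
theorem integral_tanh_substitution (f : ℝ → ℝ) :
    ∫ x in (-1:ℝ)..1, f x = ∫ u, f (tanh u) / cosh u ^ 2 := by
  have h := integral_image_eq_integral_abs_deriv_smul (s := (univ : Set ℝ)) (f := tanh)
    (f' := fun u => 1 / cosh u ^ 2) MeasurableSet.univ (fun u _ => (hasDerivAt_tanh_one_div_cosh_sq u).hasDerivWithinAt)
    tanh_injective.injOn f
  rw [image_tanh_univ, setIntegral_univ] at h
  rw [intervalIntegral.integral_of_le (by norm_num), integral_Ioc_eq_integral_Ioo, h]
  refine integral_congr_ae (ae_of_all _ fun u => ?_)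
  simp only [smul_eq_mul, abs_of_pos (by positivity : (0:ℝ) < 1 / cosh u ^ 2)]
  field_simp

/-- **sinh substitution** `x = c sinh u`, `c > 0` (the decay-improving transformation (3.4.5.1), up to the scale
`c`): for every `f`, `∫ x, f x = ∫ u, (c cosh u) f (c sinh u)`. [cite: DavisRabinowitz1984, Sect. 3.4.5 (3.4.5.1)] -/
theorem integral_sinh_substitution {c : ℝ} (hc : 0 < c) (f : ℝ → ℝ) :
    ∫ x, f x = ∫ u, (c * cosh u) * f (c * sinh u) := by
  have hinj : (univ : Set ℝ).InjOn (fun u => c * sinh u) := fun a _ b _ hab =>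
    sinh_injective (mul_left_cancel₀ hc.ne' hab)
  have h := integral_image_eq_integral_abs_deriv_smul (s := (univ : Set ℝ)) (f := fun u => c * sinh u)
    (f' := fun u => c * cosh u) MeasurableSet.univ
    (fun u _ => ((hasDerivAt_sinh u).const_mul c).hasDerivWithinAt) hinj f
  rw [image_const_mul_sinh_univ hc.ne', setIntegral_univ, setIntegral_univ] at h
  rw [h]
  refine integral_congr_ae (ae_of_all _ fun u => ?_)
  simp only [smul_eq_mul, abs_of_pos (mul_pos hc (cosh_pos u))]

/-- **exp substitution** `x = eᵘ` (the substitution of rule (3.4.5.3)): for every `f`,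
`∫ x in Ioi 0, f x = ∫ u, eᵘ f (eᵘ)`. [cite: DavisRabinowitz1984, Sect. 3.4.5 (3.4.5.3)] -/
theorem integral_exp_substitution (f : ℝ → ℝ) :
    ∫ x in Ioi 0, f x = ∫ u, exp u * f (exp u) := by
  have h := integral_image_eq_integral_abs_deriv_smul (s := (univ : Set ℝ)) (f := exp)
    (f' := exp) MeasurableSet.univ (fun u _ => (hasDerivAt_exp u).hasDerivWithinAt) exp_injective.injOn f
  rw [image_exp_univ, setIntegral_univ] at h
  rw [h]
  refine integral_congr_ae (ae_of_all _ fun u => ?_)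
  simp only [smul_eq_mul, abs_of_pos (exp_pos u)]

/-- **The unit interval onto the whole axis** (Schwartz's `x = 1/(1 + e^{-y})`, written with `y = 2u`, i.e.
`x = (1 + tanh u)/2`): for every `f`, `∫ x in 0..1, f x = ∫ u, f ((1 + tanh u)/2) / (2 cosh² u)`.
[cite: DavisRabinowitz1984, Sect. 3.4.5 (3.4.5.2)] -/
theorem integral_unitInterval_tanh_substitution (f : ℝ → ℝ) :
    ∫ x in (0:ℝ)..1, f x = ∫ u, f ((1 + tanh u) / 2) / (2 * cosh u ^ 2) := by
  have h2 : ∫ x in (0:ℝ)..1, f x = 2⁻¹ * ∫ x in (-1:ℝ)..1, f (2⁻¹ * x + 2⁻¹) := by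
    rw [intervalIntegral.integral_comp_mul_add f (by norm_num : (2:ℝ)⁻¹ ≠ 0) 2⁻¹, smul_eq_mul, ← mul_assoc]
    norm_num
  rw [h2, integral_tanh_substitution, ← _root_.MeasureTheory.integral_const_mul]
  refine integral_congr_ae (ae_of_all _ fun u => ?_)
  have hc : cosh u ≠ 0 := (cosh_pos u).ne'
  have harg : (2:ℝ)⁻¹ * tanh u + 2⁻¹ = (1 + tanh u) / 2 := by ring
  simp only [harg]
  field_simp

/-! ### The double-exponential substitutions of Takahasi–Mori for `(0, ∞)` and `ℝ` -/

/-- **DE substitution for the half line** (3.4.5.11): for every `f`,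
`∫ x in Ioi 0, f x = ∫ u, f (exp (π/2 · sinh u)) · ((π/2 · cosh u) · exp (π/2 · sinh u))`.
[cite: DavisRabinowitz1984, Sect. 3.4.5 (3.4.5.11)] -/
theorem integral_exp_sinh_substitution (f : ℝ → ℝ) :
    ∫ x in Ioi 0, f x = ∫ u, f (exp (π / 2 * sinh u)) * ((π / 2 * cosh u) * exp (π / 2 * sinh u)) := by
  rw [integral_exp_substitution, integral_sinh_substitution (c := π / 2) (by positivity)]
  refine integral_congr_ae (ae_of_all _ fun u => ?_)
  ring

/-- **DE substitution for the whole line** (3.4.5.12): for every `f`,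
`∫ x, f x = ∫ u, f (sinh (π/2 · sinh u)) · ((π/2 · cosh u) · cosh (π/2 · sinh u))`.
[cite: DavisRabinowitz1984, Sect. 3.4.5 (3.4.5.12)] -/
theorem integral_sinh_sinh_substitution (f : ℝ → ℝ) :
    ∫ x, f x = ∫ u, f (sinh (π / 2 * sinh u)) * ((π / 2 * cosh u) * cosh (π / 2 * sinh u)) := by
  rw [integral_sinh_substitution (c := 1) one_pos, integral_sinh_substitution (c := π / 2) (by positivity)]
  refine integral_congr_ae (ae_of_all _ fun u => ?_)
  simp only [one_mul]
  ring

end Literature.MeasureTheory.Integral
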